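import Literature.IUT.HodgeArakelov.LabelClassesOfCuspsCor24iProofs3
import Literature.IUT.HodgeArakelov.LabelClassesOfCuspsCor24iiProofs
import Literature.IUT.HodgeArakelov.PlusMinusTowerStableCurveBridgeGalois

/-!
# [IUTchII] Cor 2.4 (ii)(iii)′ assembled over the tower↔[IUTchI] §2 agreement (node-level closing theorem)

S. Mochizuki, *Inter-universal Teichmüller theory II*, kurims manuscript (Dec. 2020), §2, Corollary 2.4 (ii)(iii),
p. 70 l. 23–74 ([IUTchII] Cor 2.4 (ii), kurims p.70) [claim: Mochizuki2012, status: disputed] (D-0012 claim key;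
series status DISPUTED — an assembly of kernel-checked implications between typed statements; nothing of the
series is asserted).  PROOF-ONLY companion (abc-iut cell, seat abc-iut-w5-d184, holder of the sub-DAG
`plan/L6/SUBDAG-IUTchII-Cor-24.md`; cone node `IUTchII:Cor2.4(ii)`), the ASSEMBLY ROW of that sub-DAG: it composes

* the sub-DAG's own assembly `cor24_ii_iii'_of_inputs` (`LabelClassesOfCuspsCor24iiProofs.lean`, p413817:
  Cor. 2.4 (i) on the cuspidal inertia groups in `Δ_{v□}` + (S) + (E) + (a.2) ⟹ `Cor24_ii_iii' W C H`),
* abc-iut-w4-d012's node-level closing theorem for Cor. 2.4 (i), `cor24_i'_of_agreement`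
  (`LabelClassesOfCuspsCor24iProofs3.lean`: `Cor24_i'` from abc-iut-L6-t7's agreement B13, [IUTchI] Prop. 2.4 (i)
  `Prop24i`, Cor. 2.3 (ii)/(v) `Cor23ii`/`Cor23v` (abc-iut-L5-t1's predicates, BY NAME), an `ℍ`-dictionary for each
  admissible `Π_{v□}`, the Rmk. 2.4.1 datum `hΛ`, and the open-subgroup step (B) `h23vi` — GAP-LEDGER G-w4d012-2), and
* input (S) transported from [IUTchI] Cor. 2.3 (iii), `PlusMinusTower.StableCurveAgreement.boxOntoGalois_of_cor23iii`
  (`PlusMinusTowerStableCurveBridgeGalois.lean`, p414090: `Cor23iii` under `Cor23Hyp`, BY NAME, + ONE `Π`-level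
  dictionary entry `hBox`),

into ONE theorem whose hypotheses are exactly the rows of the sub-DAG: data/dictionary binders (`A`, `Dic`, `hBox`),
abc-iut-L5-t1's typed [IUTchI] §2 predicates `Prop24i`, `Cor23ii`, `Cor23v`, `Cor23Hyp`, `Cor23iii` (hypotheses, never
asserted), the Rmk. 2.4.1 datum `hΛ` (every `Π_v`-cuspidal inertia group contains, through the agreement, a nontrivial
compact pro-`Σ` subgroup of `Δ^tp_{X_v}`), the GAP `h23vi` (G-w4d012-2), input (E) `hcap` (Def. 2.3 (i)/(iv), the typed
`Def23_i_indices` for `□ ∈ {•, ▶}`), and sub-node (a.2) `hYdd` ("the cusps of `X̲_v` split completely in `Ÿ̲_v`").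
No definitions; landed modules are consumed by fully-qualified name and not edited.  Nothing here takes a side on
[IUTchIII] Cor. 3.12; typed ≠ discharged for the named inputs.
-/

namespace Literature.IUT.HodgeArakelov

open Literature.IUT.HodgeTheaters Literature.AnabelianGeometry.SemiGraphs

universe u

variable {S : BadPlaceSetting.{u}} {P : TopGroup.{u}} {T : TemperedCoverings S P}
  {D : EtaleThetaData S.toThetaSetting P} {Dsc : StableCurveTemperedData.{u}}
  (Dec : SubgraphDecomposition S T D) (W : PlusMinusTower T) (C : CuspidalInertiaData W)
  {L : LabCuspStructure C} (Ld : LabelledDecomposition Dec L) (H : Subgroup P)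

/-- **IUTchII:Cor2.4(ii)(iii)′ — node-level closing theorem over the tower↔[IUTchI] §2 agreement** (kurims p. 70;
sub-DAG `SUBDAG-IUTchII-Cor-24.md`, assembly row).  For an admissible `Π_{v□}` (`Cor24_family`: `□ ∈ {•t, ▶}`), the
typed statement of record `Cor24_ii_iii' W C H` (abc-iut-L6-d1) follows from: abc-iut-L6-t7's agreement `A` (B13) with
`ℍ`-dictionaries `Dic` (for every admissible `Π_{v□'}`) and the `Π`-level entry `hBox` for `Π_{v□}`; abc-iut-L5-t1's
[IUTchI] Prop. 2.4 (i), Cor. 2.3 (ii), (iii), (v) (`Prop24i`, `Cor23ii`, `Cor23iii` under `Cor23Hyp`, `Cor23v`); the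
Rmk. 2.4.1 datum `hΛ` for every cuspidal inertia group of `Π_v`; the open-subgroup step (B) of the printed proof of
Cor. 2.4 (i) (`h23vi`, GAP-LEDGER G-w4d012-2); input (E) "`Π^±_{v□} ∩ Π_v ⊆ Π_{v□}`" (`hcap`, Def. 2.3 (i)/(iv)); and
sub-node (a.2) "`D_t ⊆ Π^tp_{Ÿ̲_v}`" (`hYdd`) — ALL HYPOTHESES, never asserted.  PROVED (composition of
`cor24_ii_iii'_of_inputs`, `cor24_i'_of_agreement`, `StableCurveAgreement.boxOntoGalois_of_cor23iii`).
([IUTchII] Cor 2.4 (ii) p.70) [claim: Mochizuki2012, status: disputed] -/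
theorem cor24_ii_iii'_of_agreement (hH : Cor24_family Dec Ld H) (A : W.StableCurveAgreement C Dsc)
    (h24i : Dsc.Prop24i) (h23ii : Dsc.Cor23ii) (h23vD : Dsc.Cor23v) (hHyp : Dsc.Cor23Hyp)
    (h23iii : Dsc.Cor23iii)
    (hΛ : ∀ I : Subgroup W.Corhat, C.IsCuspidalInertia W.piV I →
      ∃ Λ : Subgroup Dsc.DeltaTp, IsCompact (Λ : Set Dsc.DeltaTp) ∧ Λ ≠ ⊥ ∧ IsProSigma Dsc.graph.Sigma Λ ∧
        (Λ.map Dsc.DeltaTp.subtype).map Dsc.ιX ≤ (I.subgroupOf W.pmHat).map A.eHat.toMonoidHom)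
    (Dic : ∀ H' : Subgroup P, Cor24_family Dec Ld H' → A.SubgraphDictionary H')
    (hBox : ((W.pmBox H).subgroupOf W.pmHat).map A.eHat.toMonoidHom = Dsc.piTpXH.map Dsc.ιX)
    (h23vi : ∀ I : Subgroup W.Corhat, C.IsCuspidalInertia W.piV I → ∀ H' : Subgroup P, Cor24_family Dec Ld H' →
      ∀ γ' : W.Corhat, γ' ∈ W.piPM ⊓ W.aug.ker →
        I.map (MulAut.conj γ').toMonoidHom ≤ W.pmBox H' → γ' ∈ closure (W.deltaPmBox H' : Set W.Corhat))
    (hcap : W.pmBox H ⊓ W.piV ≤ W.box H)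
    (hYdd : ∀ I : Subgroup W.Corhat, C.IsCuspidalInertia W.piV I → I ≤ W.deltaBox H →
      W.cuspDecomp I 1 ≤ (T.YddL).map (W.emb.comp T.incl)) :
    Literature.IUT.HodgeArakelov.Cor24_ii_iii' W C H :=
  cor24_ii_iii'_of_inputs
    (fun I hI hIΔ =>
      cor24_i'_of_agreement Dec W C Ld I A h24i h23ii h23vD (hIΔ.trans inf_le_right) (hΛ I hI) Dic
        (h23vi I hI) H hH)
    (A.boxOntoGalois_of_cor23iii hBox hHyp h23iii) hcap hYdd

/-- **IUTchII:Cor2.4(ii)(iii)′ for `□ = ▶` over the agreement, with (E) BY NAME** (kurims p. 70): as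
`cor24_ii_iii'_of_agreement` at `Π_{v▶} = Dec.Ptri`, input (E) being the first conjunct of abc-iut-L6-t1's typed
Def. 2.3 (i) predicate `Def23_i_indices Dec W` (node `IUTchII:Def2.3(i)`).  PROVED (modulo the named inputs).
([IUTchII] Cor 2.4 (ii) p.70) [claim: Mochizuki2012, status: disputed] -/
theorem cor24_ii_iii'_tri_of_agreement (A : W.StableCurveAgreement C Dsc) (hDef : Def23_i_indices Dec W)
    (h24i : Dsc.Prop24i) (h23ii : Dsc.Cor23ii) (h23vD : Dsc.Cor23v) (hHyp : Dsc.Cor23Hyp)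
    (h23iii : Dsc.Cor23iii)
    (hΛ : ∀ I : Subgroup W.Corhat, C.IsCuspidalInertia W.piV I →
      ∃ Λ : Subgroup Dsc.DeltaTp, IsCompact (Λ : Set Dsc.DeltaTp) ∧ Λ ≠ ⊥ ∧ IsProSigma Dsc.graph.Sigma Λ ∧
        (Λ.map Dsc.DeltaTp.subtype).map Dsc.ιX ≤ (I.subgroupOf W.pmHat).map A.eHat.toMonoidHom)
    (Dic : ∀ H' : Subgroup P, Cor24_family Dec Ld H' → A.SubgraphDictionary H')
    (hBox : ((W.pmBox Dec.Ptri).subgroupOf W.pmHat).map A.eHat.toMonoidHom = Dsc.piTpXH.map Dsc.ιX)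
    (h23vi : ∀ I : Subgroup W.Corhat, C.IsCuspidalInertia W.piV I → ∀ H' : Subgroup P, Cor24_family Dec Ld H' →
      ∀ γ' : W.Corhat, γ' ∈ W.piPM ⊓ W.aug.ker →
        I.map (MulAut.conj γ').toMonoidHom ≤ W.pmBox H' → γ' ∈ closure (W.deltaPmBox H' : Set W.Corhat))
    (hYdd : ∀ I : Subgroup W.Corhat, C.IsCuspidalInertia W.piV I → I ≤ W.deltaBox Dec.Ptri →
      W.cuspDecomp I 1 ≤ (T.YddL).map (W.emb.comp T.incl)) :
    Literature.IUT.HodgeArakelov.Cor24_ii_iii' W C Dec.Ptri :=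
  cor24_ii_iii'_of_agreement Dec W C Ld Dec.Ptri (cor24_family_tri Dec W C Ld) A h24i h23ii h23vD hHyp h23iii hΛ
    Dic hBox h23vi (W.pmBox_inf_piV_le_box_of_def23_i_indices Dec hDef (Or.inr rfl)) hYdd

end Literature.IUT.HodgeArakelov
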